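import Summits.PneNP.PneNP.Theorems.GapMCSPWindowCellZeroCounting

/-!
# Gap-MCSP window cell `q = 0` (trade-off law) — III. The flip law for read-once formulas

Part of the tree landing of HOME/decomp-pnenp-lens-1/TradeOffLaw.lean (sha256 880b490f…, lens-1 g13 of the decomp-pnenp root-decomposition cell; critic NODE-VERDICT 2026-08-30T13:09:32Z CLEARED, landing endorsed (6)(a)):
a SIZE–ACCEPTANCE TRADE-OFF for every `B₂`-circuit on `N` inputs that accepts `0^N` and every point
indicator `e_p` — `N ≤ 9·L·(L + G + 3 − N)`, `L = ⌊log₂ acc⌋`, `G` = number of gates — and its payout: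
the Oliveira–Pich–Santhanam gap problem `Gap-MCSP[2^{βn}/(cn), 2^{βn}]` (census R3) is not separated by
`B₂`-circuit families of eventually `≤ N` gates (`0 < β < 1/3`, every `c ≥ 1`), i.e. the `q = 0` cell of
the window dial of route `route-PneNP-RootDecompMagnificationPayout` (item stmt-PneNP-33309 `WindowCellZero`,
BC5 rung for the attacked item stmt-PneNP-32096). Modules, in dependency order: `…Formulas` (rooted
`B₂`-formulas and additive valuations) → `…Counting` (uniform counting, silent/flipping variables, numeric
helpers) → `…FlipLaw` (the exact acceptance law for read-once formulas) → `…Unfolding` (rooted unfolding of a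
gate list, consistency, references) → `…Potential` (variables/nodes of unfoldings, the root potential: no
duplication across root formulas) → `…Relevance` (relevant roots, link, locality) → `…Product` (boxes, the two
exponent bounds, pigeonhole, the final arithmetic) → `…Count` (`t + 2·nocc ≤ 2G + 3`) → `GapMCSPWindowCellZero`
(the law proved, the payout in tree vocabulary). Proof-internal machinery: nothing here bears on P vs NP
beyond the S-free lower bound it proves; all statements are [folklore]-tagged kernel lemmas of the lens.

THIS FILE (lens §3): the exact gate count identity `2^N·acc(g(l,r), v) = Σ_{g(a,b)=v} acc(l,a)·acc(r,b)` for a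
read-once top gate, and THE FLIP LAW: for a read-once `F` (any environment `ρ`) with base value `b = F(0^N)`,
silent variables `P` (`F(e_p) = b`) and flipping variables `Fl`: `2^{2N+|P|} ≤ 2^{2|vars|}·acc(b)²` and, if
`Fl ≠ ∅`, `2^{2N+|Fl|} ≤ 2·2^{2|vars|}·acc(¬b)²` (structural induction, four sign cases per gate).
-/

noncomputable section

set_option linter.dupNamespace false -- `Summit.PneNP.PneNP.…`: summit = sub-problem name (D-0017 single-conjunct layout)

namespace Summit.PneNP.PneNP.Theorems.GapMCSPWindowCellZero

open Literature.Computability.Complexity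

section FlipLaw

open Finset

variable {N : ℕ}

namespace BF

/-- **Gate count identity** (exact, read-once at the top gate). [folklore] -/
theorem acc_gate (ρ : Fin N ⊕ ℕ → Bool) (j : ℕ) (g : Bool → Bool → Bool) (l r : BF N)
    (hdisj : Disjoint l.vars r.vars) (v : Bool) :
    2 ^ N * acc ((gate j g l r).eval ρ) v =
      ∑ ab ∈ (univ.filter fun ab : Bool × Bool => g ab.1 ab.2 = v),
        acc (l.eval ρ) ab.1 * acc (r.eval ρ) ab.2 := by
  classical
  have step1 : acc ((gate j g l r).eval ρ) v =
      ∑ ab ∈ (univ.filter fun ab : Bool × Bool => g ab.1 ab.2 = v),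
        (univ.filter fun x : Fin N → Bool => l.eval ρ x = ab.1 ∧ r.eval ρ x = ab.2).card := by
    unfold acc
    rw [card_eq_sum_card_fiberwise (f := fun x => (l.eval ρ x, r.eval ρ x))
      (t := univ.filter fun ab : Bool × Bool => g ab.1 ab.2 = v)]
    · refine sum_congr rfl fun ab hab => ?_
      obtain ⟨a, b⟩ := ab
      simp only [mem_filter, mem_univ, true_and] at hab
      congr 1
      ext x
      simp only [mem_filter, mem_univ, true_and, eval, Prod.mk.injEq]
      constructor
      · rintro ⟨-, h1, h2⟩; exact ⟨h1, h2⟩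
      · rintro ⟨h1, h2⟩; exact ⟨by rw [h1, h2]; exact hab, h1, h2⟩
    · intro x hx
      simp only [coe_filter, Set.mem_setOf_eq, mem_univ, true_and, eval] at hx ⊢
      exact hx
  rw [step1, mul_sum]
  refine sum_congr rfl fun ab _ => ?_
  exact indep (l.dependsOn_eval ρ) (r.dependsOn_eval ρ) hdisj ab.1 ab.2

/-- One admissible pair contributes to the gate count. -/
theorem term_le_acc_gate (ρ : Fin N ⊕ ℕ → Bool) (j : ℕ) (g : Bool → Bool → Bool) (l r : BF N)
    (hdisj : Disjoint l.vars r.vars) (a b : Bool) :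
    acc (l.eval ρ) a * acc (r.eval ρ) b ≤ 2 ^ N * acc ((gate j g l r).eval ρ) (g a b) := by
  classical
  rw [acc_gate ρ j g l r hdisj]
  have hmem : (a, b) ∈ univ.filter (fun ab : Bool × Bool => g ab.1 ab.2 = g a b) := by simp
  exact single_le_sum (f := fun ab : Bool × Bool => acc (l.eval ρ) ab.1 * acc (r.eval ρ) ab.2)
    (fun _ _ => Nat.zero_le _) hmem

/-- Two distinct admissible pairs contribute to the gate count. -/
theorem two_terms_le_acc_gate (ρ : Fin N ⊕ ℕ → Bool) (j : ℕ) (g : Bool → Bool → Bool) (l r : BF N)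
    (hdisj : Disjoint l.vars r.vars) (a b a' b' v : Bool) (hne : (a, b) ≠ (a', b'))
    (h1 : g a b = v) (h2 : g a' b' = v) :
    acc (l.eval ρ) a * acc (r.eval ρ) b + acc (l.eval ρ) a' * acc (r.eval ρ) b' ≤
      2 ^ N * acc ((gate j g l r).eval ρ) v := by
  classical
  rw [acc_gate ρ j g l r hdisj]
  have hsub : ({(a, b), (a', b')} : Finset (Bool × Bool)) ⊆
      univ.filter fun ab : Bool × Bool => g ab.1 ab.2 = v := by
    intro ab hab
    simp only [mem_insert, mem_singleton] at hab
    rcases hab with rfl | rfl <;> simp [h1, h2]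
  calc acc (l.eval ρ) a * acc (r.eval ρ) b + acc (l.eval ρ) a' * acc (r.eval ρ) b'
      = ∑ ab ∈ ({(a, b), (a', b')} : Finset (Bool × Bool)),
          acc (l.eval ρ) ab.1 * acc (r.eval ρ) ab.2 := by rw [sum_pair hne]
    _ ≤ _ := sum_le_sum_of_subset_of_nonneg hsub (fun _ _ _ => Nat.zero_le _)

/-- **THE FLIP LAW** (silent law ∧ flip law) for read-once formulas. [folklore] -/
theorem flipLaw (ρ : Fin N ⊕ ℕ → Bool) (F : BF N) (hF : F.ReadOnce) :
    2 ^ (2 * N + (sil (F.eval ρ) F.vars).card) ≤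
        1 * 2 ^ (2 * F.vars.card) * acc (F.eval ρ) (F.eval ρ x0) ^ 2 ∧
      ((flp (F.eval ρ) F.vars).Nonempty →
        2 ^ (2 * N + (flp (F.eval ρ) F.vars).card) ≤
          2 * 2 ^ (2 * F.vars.card) * acc (F.eval ρ) (! F.eval ρ x0) ^ 2) := by
  classical
  induction F with
  | lit p c =>
    have hdep : DependsOn ((lit p c : BF N).eval ρ) {p} := (lit p c : BF N).dependsOn_eval ρ
    have hvars : (lit p c : BF N).vars = {p} := rfl
    have hflip : (lit p c : BF N).eval ρ (e p) ≠ (lit p c : BF N).eval ρ x0 := by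
      cases c <;> simp [eval]
    have hsil : sil ((lit p c : BF N).eval ρ) {p} = ∅ := by
      refine filter_eq_empty_iff.2 fun q hq => ?_
      rw [mem_singleton.1 hq]; exact hflip
    have hflp : flp ((lit p c : BF N).eval ρ) {p} = {p} := by
      refine (filter_eq_self).2 fun q hq => ?_
      rw [mem_singleton.1 hq]; exact hflip
    rw [hvars, hsil, hflp]
    have h1 := cylinder hdep (rfl : (lit p c : BF N).eval ρ x0 = _)
    have h2 := cylinder hdep (Bool.eq_not_iff.2 hflip)
    simp only [card_singleton, pow_one, card_empty, add_zero] at h1 h2 ⊢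
    have h1' := Nat.mul_le_mul h1 h1
    have h2' := Nat.mul_le_mul h2 h2
    constructor
    · calc 2 ^ (2 * N) = 2 ^ N * 2 ^ N := by ring
        _ ≤ _ := h1'
        _ = 1 * 2 ^ (2 * 1) * acc ((lit p c : BF N).eval ρ) ((lit p c : BF N).eval ρ x0) ^ 2 := by ring
    · intro _
      calc 2 ^ (2 * N + 1) = 2 * (2 ^ N * 2 ^ N) := by ring
        _ ≤ 2 * _ := Nat.mul_le_mul_left 2 h2'
        _ = 2 * 2 ^ (2 * 1) * acc ((lit p c : BF N).eval ρ) (! (lit p c : BF N).eval ρ x0) ^ 2 := by ring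
  | cst c =>
    have hvars : (cst c : BF N).vars = ∅ := rfl
    rw [hvars]
    have hacc : acc ((cst c : BF N).eval ρ) ((cst c : BF N).eval ρ x0) = 2 ^ N := by
      unfold acc; simp [eval]
    refine ⟨?_, fun h => absurd h (by simp [flp])⟩
    rw [hacc]; simp [sil]; ring_nf; exact le_rfl
  | ref w =>
    have hvars : (ref w : BF N).vars = ∅ := rfl
    rw [hvars]
    have hacc : acc ((ref w : BF N).eval ρ) ((ref w : BF N).eval ρ x0) = 2 ^ N := by
      unfold acc; simp [eval]
    refine ⟨?_, fun h => absurd h (by simp [flp])⟩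
    rw [hacc]; simp [sil]; ring_nf; exact le_rfl
  | gate j g l r ihl ihr =>
    obtain ⟨hl, hr, hdisj⟩ := hF
    obtain ⟨ihl1, ihl2⟩ := ihl hl
    obtain ⟨ihr1, ihr2⟩ := ihr hr
    -- names
    set f := (gate j g l r).eval ρ with hfdef
    set fl := l.eval ρ with hfl
    set fr := r.eval ρ with hfr
    have hf : ∀ x, f x = g (fl x) (fr x) := fun x => by simp [hfdef, hfl, hfr, eval]
    set βl := fl x0 with hβl
    set βr := fr x0 with hβr
    have hβ : f x0 = g βl βr := hf x0
    set a := acc fl βl with ha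
    set a' := acc fl (!βl) with ha'
    set b := acc fr βr with hb
    set b' := acc fr (!βr) with hb'
    have haa : a + a' = 2 ^ N := acc_add_acc_not fl βl
    have hbb : b + b' = 2 ^ N := acc_add_acc_not fr βr
    set vl := l.vars.card with hvl
    set vr := r.vars.card with hvr
    have hV : (l.vars ∪ r.vars).card = vl + vr := by rw [card_union_of_disjoint hdisj]
    have hvarsg : (gate j g l r).vars = l.vars ∪ r.vars := rfl
    rw [hvarsg, sil_union, flp_union, hV]
    -- pattern sizes `≥ 1`
    have hA : 2 ^ N ≤ 2 ^ vl * a := by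
      apply le_of_sq_le_sq
      calc (2 ^ N) ^ 2 = 2 ^ (2 * N + 0) := by ring
        _ ≤ 2 ^ (2 * N + (sil fl l.vars).card) := Nat.pow_le_pow_right (by norm_num) (by omega)
        _ ≤ 1 * 2 ^ (2 * vl) * a ^ 2 := ihl1
        _ = (2 ^ vl * a) ^ 2 := by ring
    have hB : 2 ^ N ≤ 2 ^ vr * b := by
      apply le_of_sq_le_sq
      calc (2 ^ N) ^ 2 = 2 ^ (2 * N + 0) := by ring
        _ ≤ 2 ^ (2 * N + (sil fr r.vars).card) := Nat.pow_le_pow_right (by norm_num) (by omega)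
        _ ≤ 1 * 2 ^ (2 * vr) * b ^ 2 := ihr1
        _ = (2 ^ vr * b) ^ 2 := by ring
    have hA' : (flp fl l.vars).Nonempty → 2 ^ N ≤ 2 ^ vl * a' := fun hne => by
      apply le_of_sq_le_sq
      have := ihl2 hne
      have h1 : 1 ≤ (flp fl l.vars).card := card_pos.2 hne
      have h2 : 2 * (2 ^ N) ^ 2 ≤ 2 * (2 ^ vl * a') ^ 2 :=
        calc 2 * (2 ^ N) ^ 2 = 2 ^ (2 * N + 1) := by ring
          _ ≤ 2 ^ (2 * N + (flp fl l.vars).card) := Nat.pow_le_pow_right (by norm_num) (by omega)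
          _ ≤ 2 * 2 ^ (2 * vl) * a' ^ 2 := this
          _ = 2 * (2 ^ vl * a') ^ 2 := by ring
      exact Nat.le_of_mul_le_mul_left h2 (by norm_num)
    have hB' : (flp fr r.vars).Nonempty → 2 ^ N ≤ 2 ^ vr * b' := fun hne => by
      apply le_of_sq_le_sq
      have := ihr2 hne
      have h1 : 1 ≤ (flp fr r.vars).card := card_pos.2 hne
      have h2 : 2 * (2 ^ N) ^ 2 ≤ 2 * (2 ^ vr * b') ^ 2 :=
        calc 2 * (2 ^ N) ^ 2 = 2 ^ (2 * N + 1) := by ring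
          _ ≤ 2 ^ (2 * N + (flp fr r.vars).card) := Nat.pow_le_pow_right (by norm_num) (by omega)
          _ ≤ 2 * 2 ^ (2 * vr) * b' ^ 2 := this
          _ = 2 * (2 ^ vr * b') ^ 2 := by ring
      exact Nat.le_of_mul_le_mul_left h2 (by norm_num)
    -- the right child is constant on the left child's indicators and vice versa
    have hrconst : ∀ p ∈ l.vars, fr (e p) = fr x0 := fun p hp =>
      r.eval_congr ρ fun q hq => by
        have : q ≠ p := fun h => Finset.disjoint_left.1 hdisj hp (h ▸ hq)
        simp [e_apply_of_ne this]
    have hlconst : ∀ p ∈ r.vars, fl (e p) = fl x0 := fun p hp =>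
      l.eval_congr ρ fun q hq => by
        have : q ≠ p := fun h => Finset.disjoint_left.1 hdisj (h ▸ hq) hp
        simp [e_apply_of_ne this]
    obtain ⟨hPl, hFl, hFl0⟩ := side_bounds f fl fr g hf l.vars hrconst
    obtain ⟨hPr, hFr, hFr0⟩ :=
      side_bounds f fr fl (fun y x => g x y) (fun x => hf x) r.vars hlconst
    have hflcard : (flp fl l.vars).card ≤ vl := card_le_card (flp_subset _ _)
    have hfrcard : (flp fr r.vars).card ≤ vr := card_le_card (flp_subset _ _)
    have hcardP : (sil f l.vars ∪ sil f r.vars).card ≤ (sil f l.vars).card + (sil f r.vars).card :=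
      card_union_le _ _
    have hcardF : (flp f l.vars ∪ flp f r.vars).card ≤ (flp f l.vars).card + (flp f r.vars).card :=
      card_union_le _ _
    have hFl' : (flp f l.vars).card ≤ (flp fl l.vars).card := card_le_card hFl
    have hFr' : (flp f r.vars).card ≤ (flp fr r.vars).card := card_le_card hFr
    -- admissible-pair inequalities
    have t1 : a * b ≤ 2 ^ N * acc f (f x0) := by
      rw [hβ]; exact term_le_acc_gate ρ j g l r hdisj βl βr
    -- absorb facts
    have absorb_b : g (!βl) βr = g βl βr → b ≤ acc f (f x0) := fun hs => by
      have h2 := two_terms_le_acc_gate ρ j g l r hdisj βl βr (!βl) βr (g βl βr)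
        (by cases βl <;> simp) rfl hs
      rw [← add_mul, haa, ← hβ] at h2
      exact Nat.le_of_mul_le_mul_left h2 (by positivity)
    have absorb_a : g βl (!βr) = g βl βr → a ≤ acc f (f x0) := fun hs => by
      have h2 := two_terms_le_acc_gate ρ j g l r hdisj βl βr βl (!βr) (g βl βr)
        (by cases βr <;> simp) rfl hs
      rw [← mul_add, hbb, ← hβ, mul_comm] at h2
      exact Nat.le_of_mul_le_mul_left h2 (by positivity)
    rw [← hβl, ← hβr] at hPl hFl0 hPr hFr0
    refine ⟨?_, ?_⟩
    · -- SILENT LAW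
      refine le_trans (Nat.pow_le_pow_right (by norm_num) (Nat.add_le_add_left (hcardP.trans
        (Nat.add_le_add hPl hPr)) _)) ?_
      by_cases hs1 : g (!βl) βr = f x0 <;> by_cases hs2 : g βl (!βr) = f x0
      · -- `side_bounds` for the right side is stated with `fun y x => g x y`
        simp only [hs1, hs2, if_true]
        rw [hβ] at hs1 hs2
        exact num_absorb₂ (absorb_a hs2) (absorb_b hs1) hA hB
      · simp only [hs1, hs2, if_true, if_false]
        rw [hβ] at hs1
        exact num_absorb (absorb_b hs1) ihr1
      · simp only [hs1, hs2, if_true, if_false]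
        rw [hβ] at hs2
        have := num_absorb (va := vr) (absorb_a hs2) ihl1
        calc 2 ^ (2 * N + ((sil fl l.vars).card + vr))
            = 2 ^ (2 * N + (vr + (sil fl l.vars).card)) := by ring_nf
          _ ≤ 1 * 2 ^ (2 * (vr + vl)) * acc f (f x0) ^ 2 := this
          _ = 1 * 2 ^ (2 * (vl + vr)) * acc f (f x0) ^ 2 := by rw [Nat.add_comm vr vl]
      · simp only [hs1, hs2, if_false]
        have := num_prod t1 ihl1 ihr1
        simpa using this
    · -- FLIP LAW
      intro hne
      refine le_trans (Nat.pow_le_pow_right (by norm_num) (Nat.add_le_add_left hcardF _)) ?_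
      by_cases hs1 : g (!βl) βr = f x0 <;> by_cases hs2 : g βl (!βr) = f x0
      · -- nothing flips: contradiction
        exfalso
        rw [hFl0 hs1, hFr0 hs2] at hne
        simp at hne
      · -- only the right side can flip
        rw [hFl0 hs1]
        have hner : (flp fr r.vars).Nonempty := by
          rw [hFl0 hs1, empty_union] at hne
          exact hne.mono hFr
        have hs2' : g βl (!βr) = ! f x0 := Bool.eq_not_iff.2 hs2
        have t : a * b' ≤ 2 ^ N * acc f (! f x0) := by
          rw [← hs2']; exact term_le_acc_gate ρ j g l r hdisj βl (!βr)
        have habs : a ≤ 2 ^ N := acc_le _ _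
        simp only [card_empty, zero_add]
        refine le_trans (Nat.pow_le_pow_right (by norm_num) (Nat.add_le_add_left hFr' _)) ?_
        -- use the product lemma with the silent bound for `a` (exponent 0) and flip bound for `b'`
        have iha0 : 2 ^ (2 * N + 0) ≤ 1 * 2 ^ (2 * vl) * a ^ 2 :=
          le_trans (Nat.pow_le_pow_right (by norm_num) (by omega)) ihl1
        have := num_prod t iha0 (ihr2 hner)
        simpa using this
      · -- only the left side can flip
        rw [hFr0 hs2]
        have hnel : (flp fl l.vars).Nonempty := by
          rw [hFr0 hs2, union_empty] at hne
          exact hne.mono hFl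
        have hs1' : g (!βl) βr = ! f x0 := Bool.eq_not_iff.2 hs1
        have t : a' * b ≤ 2 ^ N * acc f (! f x0) := by
          rw [← hs1']; exact term_le_acc_gate ρ j g l r hdisj (!βl) βr
        simp only [card_empty, add_zero]
        refine le_trans (Nat.pow_le_pow_right (by norm_num) (Nat.add_le_add_left hFl' _)) ?_
        have ihb0 : 2 ^ (2 * N + 0) ≤ 1 * 2 ^ (2 * vr) * b ^ 2 :=
          le_trans (Nat.pow_le_pow_right (by norm_num) (by omega)) ihr1
        have := num_prod t (ihl2 hnel) ihb0
        simpa using this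
      · -- both sides may flip
        have hs1' : g (!βl) βr = ! f x0 := Bool.eq_not_iff.2 hs1
        have hs2' : g βl (!βr) = ! f x0 := Bool.eq_not_iff.2 hs2
        refine le_trans (Nat.pow_le_pow_right (by norm_num)
          (Nat.add_le_add_left (Nat.add_le_add hFl' hFr') _)) ?_
        by_cases hnel : (flp fl l.vars).Nonempty <;> by_cases hner : (flp fr r.vars).Nonempty
        · have t := two_terms_le_acc_gate ρ j g l r hdisj (!βl) βr βl (!βr) (! f x0)
            (by cases βl <;> simp) hs1' hs2'
          exact num_twoflip t (num_halves haa hA (hA' hnel)) (num_halves hbb hB (hB' hner))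
            hflcard hfrcard
        · rw [not_nonempty_iff_eq_empty.1 hner, card_empty]
          have t : a' * b ≤ 2 ^ N * acc f (! f x0) := by
            rw [← hs1']; exact term_le_acc_gate ρ j g l r hdisj (!βl) βr
          have ihb0 : 2 ^ (2 * N + 0) ≤ 1 * 2 ^ (2 * vr) * b ^ 2 :=
            le_trans (Nat.pow_le_pow_right (by norm_num) (by omega)) ihr1
          have := num_prod t (ihl2 hnel) ihb0
          simpa using this
        · rw [not_nonempty_iff_eq_empty.1 hnel, card_empty]
          have t : a * b' ≤ 2 ^ N * acc f (! f x0) := by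
            rw [← hs2']; exact term_le_acc_gate ρ j g l r hdisj βl (!βr)
          have iha0 : 2 ^ (2 * N + 0) ≤ 1 * 2 ^ (2 * vl) * a ^ 2 :=
            le_trans (Nat.pow_le_pow_right (by norm_num) (by omega)) ihl1
          have := num_prod t iha0 (ihr2 hner)
          simpa using this
        · exfalso
          rw [not_nonempty_iff_eq_empty] at hnel hner
          have h1 : flp f l.vars = ∅ := subset_empty.1 (hnel ▸ hFl)
          have h2 : flp f r.vars = ∅ := subset_empty.1 (hner ▸ hFr)
          rw [h1, h2] at hne
          simp at hne

end BF

end FlipLaw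

end Summit.PneNP.PneNP.Theorems.GapMCSPWindowCellZero
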